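import Literature.Algebra.EuclideanLattices.LLLCapModel
import Literature.Algebra.EuclideanLattices.LLLAlgorithmSize
import HarnessLib

/-!
# Sizes along the LLL run, pass by pass: the saturated machine model agrees with LLL

Trunk: Lattice; continues `LLLAlgorithmSize.lean` (LLL82's bound `‖bᵢ‖² ≤ n²(4B)ⁿ` on the states
of the run, `lll_norm_sq_le_holds`) and `LLLCapModel.lean` (the saturated integral step `capStep W`
and `capStep_eq_intStep`: it is Cohen's integral step as soon as every matrix met *during* the
pass — the current one, the one after `RED(k,k-1)`, and those of the descending size-reduction
loop, `intPassMatrices` — has short entries and a short triangular `u`-table, `Fits W`). This file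
supplies the missing quantitative link, i.e. the part of the proof of Prop. 1.26 of A. K. Lenstra,
H. W. Lenstra Jr., L. Lovász, *Factoring polynomials with rational coefficients*, Math. Ann. 261
(1982), saying that **all integers met by the algorithm have binary length `O(n log B)`**, in the
crude polynomial form a machine needs:

* `norm_gsPartial_le`, `abs_gsU_le`: `|uₗ(i,j)| = dₗ |⟪bᵢ, πₗ bⱼ⟫| ≤ dₗ ‖bᵢ‖ ‖bⱼ‖`;
* `abs_gsCoeff_lllSizeReduce_le_of`: one size reduction `RED(k,l)` against a size-reduced row at
  most doubles `maxⱼ |μₖⱼ|` (LLL82 (1.31)–(1.32): "each execution of (∗) … multiplies `max |μₖⱼ|`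
  by at most `2`", Bremner Thm. 4.23 proof), hence along the descending loop the row being reduced
  stays within `‖bₖ‖² ≤ n M² S₀` for `M = 2ⁿ(2S₀ⁿ + 1)` (`PassGood`, `passGood_of_mem_intPassMatrices`);
* `fits_of_mem_intPassMatrices`: with `S₀ = n²(4B)ⁿ` the bound of `lll_norm_sq_le`, every pass
  matrix `c` fits any width `W` with `S₀ⁿ · n M² S₀ < 2^W`;
* `lllBudget L = 64 (L+1)³` and, for a nonsingular instance `I` of code length `L`:
  `fits_run` (every pass matrix of every state of the run fits width `lllBudget L`),
  `halted_run` (the state at time `lllBudget L` is halted), and the conclusion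
  **`LatticeInstance.capRun_eq_lllReduce`**: `lllBudget L` rounds of `capStep (lllBudget L)` from the
  start state carry `LatticeInstance.lllReduce I` — the functional half of `lllReduce_polyTime`.

## References

* A. K. Lenstra, H. W. Lenstra Jr., L. Lovász, Math. Ann. 261 (1982), Prop. 1.26 and its proof
  ((1.30)–(1.35): the sizes of the `bᵢ`, `μᵢⱼ`, `dᵢ` during the algorithm).
* M. R. Bremner, *Lattice Basis Reduction*, CRC Press 2011, Thm. 4.23.
* H. Cohen, *A Course in Computational Algebraic Number Theory*, GTM 138, 1993, Algorithm 2.6.7.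
-/

noncomputable section

namespace Literature.Algebra.EuclideanLattices

open InnerProductSpace Function Submodule Finset
open scoped RealInnerProductSpace

/-! ### Norm bounds for the Gram–Schmidt data -/

section GS

variable {E : Type*} [NormedAddCommGroup E] [InnerProductSpace ℝ E] {n : ℕ}

/-- `‖b*ⱼ‖ ≤ ‖bⱼ‖` (`bⱼ = b*ⱼ + ∑ μⱼₗ b*ₗ` orthogonally). [folklore] -/
theorem norm_gramSchmidt_le (f : Fin n → E) (j : Fin n) : ‖gramSchmidt ℝ f j‖ ≤ ‖f j‖ := by
  have h : ‖gramSchmidt ℝ f j‖ ^ 2 ≤ ‖f j‖ ^ 2 := by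
    rw [sq_norm_eq_sq_norm_gramSchmidt_add_sum f j]
    exact le_add_of_nonneg_right (Finset.sum_nonneg fun l _ => mul_nonneg (sq_nonneg _) (sq_nonneg _))
  exact (pow_le_pow_iff_left₀ (norm_nonneg _) (norm_nonneg _) two_ne_zero).1 h

/-- **The partial Gram–Schmidt reduction is a contraction**: `‖πₗ(x)‖ ≤ ‖x‖` (`x = πₗ(x) + p` with
`p` in the span of `b₀, …, bₗ₋₁`, which is orthogonal to `πₗ(x)`). [folklore] -/
theorem norm_gsPartial_le (f : Fin n → E) (l : ℕ) (hl : l ≤ n) (x : E) : ‖gsPartial f l hl x‖ ≤ ‖x‖ := by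
  set π := gsPartial f l hl x with hπ
  have horth : ∀ y ∈ span ℝ (Set.range (f ∘ Fin.castLE hl)), ⟪y, π⟫ = 0 := by
    intro y hy
    induction hy using Submodule.span_induction with
    | mem y hy => obtain ⟨i, rfl⟩ := hy; exact inner_gsPartial_eq_zero f l hl x i
    | zero => exact inner_zero_left _
    | add y z _ _ hy hz => rw [inner_add_left, hy, hz, add_zero]
    | smul c y _ hy => rw [real_inner_smul_left, hy, mul_zero]
  have hp : ⟪x - π, π⟫ = 0 := horth _ (sub_gsPartial_mem_span f l hl x)
  have hdecomp : ‖x‖ ^ 2 = ‖x - π‖ ^ 2 + ‖π‖ ^ 2 := by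
    have := norm_add_sq_eq_norm_sq_add_norm_sq_real hp
    rw [sub_add_cancel] at this
    simp only [sq]; linarith
  have h : ‖π‖ ^ 2 ≤ ‖x‖ ^ 2 := by rw [hdecomp]; exact le_add_of_nonneg_left (sq_nonneg _)
  exact (pow_le_pow_iff_left₀ (norm_nonneg _) (norm_nonneg _) two_ne_zero).1 h

/-- **`|uₗ(i,j)| ≤ dₗ ‖bᵢ‖ ‖bⱼ‖`** (Cauchy–Schwarz and `‖πₗ bⱼ‖ ≤ ‖bⱼ‖`).
[cite: LenstraLenstraLovasz1982, Prop. 1.26 (proof)] -/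
theorem abs_gsU_le (f : Fin n → E) (l : ℕ) (hl : l ≤ n) (i j : Fin n) :
    |gsU f l hl i j| ≤ gramDet f l hl * ‖f i‖ * ‖f j‖ := by
  rw [gsU, abs_mul, abs_of_nonneg (gramDet_nonneg f l hl), mul_assoc]
  refine mul_le_mul_of_nonneg_left ?_ (gramDet_nonneg f l hl)
  exact (abs_real_inner_le_norm _ _).trans (mul_le_mul_of_nonneg_left (norm_gsPartial_le f l hl _) (norm_nonneg _))

/-- `μₐⱼ` depends only on the row `a` and on the Gram–Schmidt vectors. [folklore] -/
theorem gsCoeff_congr_of_row_eq {f g : Fin n → E} {a : Fin n} (hfa : f a = g a)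
    (hGS : gramSchmidt ℝ f = gramSchmidt ℝ g) (j : Fin n) : gsCoeff f a j = gsCoeff g a j := by
  unfold gsCoeff; rw [hfa, hGS]

/-- `μₗⱼ = 0` for `l < j`. [folklore] -/
theorem gsCoeff_eq_zero_of_lt' (f : Fin n → E) {l j : Fin n} (h : l < j) : gsCoeff f l j = 0 := by
  unfold gsCoeff; rw [real_inner_comm, gramSchmidt_inv_triangular ℝ f h, zero_div]

end GS

/-! ### One size reduction at most doubles the coefficients of the reduced row -/

section OneRed

variable {E : Type*} [NormedAddCommGroup E] [InnerProductSpace ℝ E]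
variable {V : Type*} [AddCommGroup V] (φ : V →+ E) {n : ℕ}

/-- **LLL82 (1.31)–(1.32), one step**: if `|μₖⱼ| ≤ M` for all `j < k` (`M ≥ 0`) and row `l < k` is
size-reduced below the diagonal, then after `reduce(k, l)` every `|μₖⱼ|`, `j < k`, is at most
`2M + ½` (`μₖⱼ ← μₖⱼ - r μₗⱼ` with `|r| ≤ M + ½`, `|μₗⱼ| ≤ ½` for `j < l`, `μₗⱼ = 0` for `j > l`,
and `|μₖₗ| ≤ ½` afterwards). [cite: LenstraLenstraLovasz1982, Prop. 1.26 (proof, (1.31)–(1.32))] [cite: Bremner2011, Thm. 4.23 (proof)] -/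
theorem abs_gsCoeff_lllSizeReduce_le_of (b : Fin n → V) {k l : Fin n} (hlk : l < k) {M : ℝ} (hM0 : 0 ≤ M)
    (hM : ∀ j : Fin n, j < k → |gsCoeff (⇑φ ∘ b) k j| ≤ M)
    (hred : ∀ j : Fin n, j < l → |gsCoeff (⇑φ ∘ b) l j| ≤ 1 / 2) (j : Fin n) (hj : j < k) :
    |gsCoeff (⇑φ ∘ lllSizeReduce φ b k l) k j| ≤ 2 * M + 1 / 2 := by
  obtain ⟨c, hc, heq⟩ := exists_comp_lllSizeReduce_eq_abs_le φ b k l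
  have hcM : |c| ≤ M + 1 / 2 := hc.trans (by linarith [hM l hlk])
  rcases lt_trichotomy j l with hjl | rfl | hlj
  · rw [heq, gsCoeff_update_sub_smul_self _ hlk c j]
    have h1 := hM j hj
    have h2 := hred j hjl
    calc |gsCoeff (⇑φ ∘ b) k j - c * gsCoeff (⇑φ ∘ b) l j|
        ≤ |gsCoeff (⇑φ ∘ b) k j| + |c| * |gsCoeff (⇑φ ∘ b) l j| := by rw [← abs_mul]; exact abs_sub _ _
      _ ≤ M + (M + 1 / 2) * (1 / 2) := add_le_add h1 (mul_le_mul hcM h2 (abs_nonneg _) (by linarith))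
      _ ≤ 2 * M + 1 / 2 := by linarith
  · exact (abs_gsCoeff_lllSizeReduce_le φ b hlk).trans (by linarith)
  · rw [heq, gsCoeff_update_sub_smul_self _ hlk c j, gsCoeff_eq_zero_of_lt' _ hlj, mul_zero, sub_zero]
    exact (hM j hj).trans (by linarith)

end OneRed

/-! ### The matrices of one pass -/

section Pass

variable {n m : ℕ}

set_option quotPrecheck false in
set_option hygiene false in
/-- The measuring map `ℤᵐ → ℝᵐ` of the integer case (local shorthand). -/
local notation "φ" => (intVecToEuclidean m).toAddMonoidHom

/-- **What a matrix met during the pass at state `s` (current index `k`) looks like**: rows other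
than `k` are those of `s`, the Gram–Schmidt vectors are those of `s`, the family is linearly
independent, and the coefficients of row `k` are bounded by `M`. [cite: LenstraLenstraLovasz1982, Prop. 1.26 (proof)] -/
structure PassGood (s : LLLState n (Fin m → ℤ)) (k : Fin n) (c : Fin n → (Fin m → ℤ)) (M : ℝ) : Prop where
  /-- rows `i ≠ k` are unchanged -/
  rows : ∀ i : Fin n, i ≠ k → c i = s.b i
  /-- the Gram–Schmidt vectors are unchanged -/
  gs : gramSchmidt ℝ (⇑φ ∘ c) = gramSchmidt ℝ (⇑φ ∘ s.b)
  /-- the family stays linearly independent -/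
  indep : LinearIndependent ℝ (⇑φ ∘ c)
  /-- the coefficients of row `k` are bounded -/
  coeff : ∀ j : Fin n, j < k → |gsCoeff (⇑φ ∘ c) k j| ≤ M

namespace PassGood

variable {s : LLLState n (Fin m → ℤ)} {k : Fin n} {c : Fin n → (Fin m → ℤ)} {M M' : ℝ}

/-- Weakening the coefficient bound. [folklore] -/
theorem mono (h : PassGood s k c M) (hMM' : M ≤ M') : PassGood s k c M' :=
  ⟨h.rows, h.gs, h.indep, fun j hj => (h.coeff j hj).trans hMM'⟩

/-- The state's own matrix. [folklore] -/
theorem self (hli : LinearIndependent ℝ (⇑φ ∘ s.b)) (hM : ∀ j : Fin n, j < k → |gsCoeff (⇑φ ∘ s.b) k j| ≤ M) :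
    PassGood s k s.b M := ⟨fun _ _ => rfl, rfl, hli, hM⟩

/-- **One `RED(k, l)` keeps the shape and at most doubles the bound**, provided the rows below `k`
of the state are size-reduced (the loop invariant). [cite: LenstraLenstraLovasz1982, Prop. 1.26 (proof)] -/
theorem intSizeReduce (h : PassGood s k c M) (hM0 : 0 ≤ M)
    (hsred : ∀ i j : Fin n, j < i → i < k → |gsCoeff (⇑φ ∘ s.b) i j| ≤ 1 / 2) {l : Fin n} (hlk : l < k) :
    PassGood s k (intSizeReduce c k l) (2 * M + 1 / 2) := by
  rw [intSizeReduce_eq c h.indep]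
  refine ⟨fun i hi => ?_, ?_, ?_, fun j hj => ?_⟩
  · rw [lllSizeReduce_apply_of_ne φ c k l hi, h.rows i hi]
  · rw [gramSchmidt_lllSizeReduce φ c hlk, h.gs]
  · have := linearIndependent_intSizeReduce c h.indep hlk
    rwa [intSizeReduce_eq c h.indep] at this
  · refine abs_gsCoeff_lllSizeReduce_le_of φ c hlk hM0 h.coeff (fun j' hj' => ?_) j hj
    have hrow : (⇑φ ∘ c) l = (⇑φ ∘ s.b) l := by
      simp only [comp_apply]; rw [h.rows l (ne_of_lt hlk)]
    rw [gsCoeff_congr_of_row_eq hrow h.gs]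
    exact hsred l j' hj' hlk

/-- **Along the descending loop** `RED(k, a-1), …, RED(k, 0)` the bound grows to at most
`2ᵃ (M + ½)`. [cite: LenstraLenstraLovasz1982, Prop. 1.26 (proof, (1.32))] -/
theorem chain (hsred : ∀ i j : Fin n, j < i → i < k → |gsCoeff (⇑φ ∘ s.b) i j| ≤ 1 / 2) :
    ∀ (a : ℕ) (ha : a ≤ n) (_ : a ≤ k) (c : Fin n → (Fin m → ℤ)) (M : ℝ), 0 ≤ M → PassGood s k c M →
      ∀ c' ∈ intRedChain k a ha c, PassGood s k c' (2 ^ a * (M + 1 / 2))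
  | 0, _, _, _, _, _, _ => by simp [intRedChain]
  | a + 1, ha, hak, c, M, hM0, h => by
    intro c' hc'
    have hlk : (⟨a, ha⟩ : Fin n) < k := Fin.mk_lt_of_lt_val hak
    have h1 : PassGood s k (Literature.Algebra.EuclideanLattices.intSizeReduce c k ⟨a, ha⟩) (2 * M + 1 / 2) :=
      h.intSizeReduce hM0 hsred hlk
    simp only [intRedChain, List.mem_cons] at hc'
    rcases hc' with rfl | hc'
    · refine h1.mono ?_
      have : (2 : ℝ) ≤ 2 ^ (a + 1) := by
        calc (2 : ℝ) = 2 ^ 1 := by norm_num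
          _ ≤ 2 ^ (a + 1) := pow_le_pow_right₀ (by norm_num) (by omega)
      nlinarith
    · have := chain hsred a (Nat.le_of_succ_le ha) (Nat.le_of_succ_le hak) _ _ (by linarith) h1 c' hc'
      refine this.mono (le_of_eq ?_)
      rw [pow_succ]; ring

end PassGood

/-- **Every matrix of the pass** at a running state `s` (index `0 < k < n`, rows below `k`
size-reduced, `|μₖⱼ| ≤ M` for `j < k`) has the shape `PassGood` with bound `2ⁿ (2M + 1)`.
[cite: LenstraLenstraLovasz1982, Prop. 1.26 (proof)] -/
theorem passGood_of_mem_intPassMatrices (s : LLLState n (Fin m → ℤ)) (hk : 0 < s.k ∧ s.k < n)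
    (hli : LinearIndependent ℝ (⇑φ ∘ s.b))
    (hsred : ∀ i j : Fin n, j < i → (i : ℕ) < s.k → |gsCoeff (⇑φ ∘ s.b) i j| ≤ 1 / 2) {M : ℝ} (hM0 : 0 ≤ M)
    (hM : ∀ j : Fin n, (j : ℕ) < s.k → |gsCoeff (⇑φ ∘ s.b) ⟨s.k, hk.2⟩ j| ≤ M) :
    ∀ c ∈ intPassMatrices s, PassGood s ⟨s.k, hk.2⟩ c (2 ^ n * (2 * M + 1)) := by
  set k : Fin n := ⟨s.k, hk.2⟩ with hkdef
  set j₀ : Fin n := ⟨s.k - 1, by omega⟩ with hj₀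
  have hjk : j₀ < k := Fin.mk_lt_mk.2 (by omega)
  have hsred' : ∀ i j : Fin n, j < i → i < k → |gsCoeff (⇑φ ∘ s.b) i j| ≤ 1 / 2 :=
    fun i j hji hik => hsred i j hji (Fin.lt_def.1 hik)
  have h0 : PassGood s k s.b M := PassGood.self hli fun j hj => hM j (Fin.lt_def.1 hj)
  have h1 : PassGood s k (intSizeReduce s.b k j₀) (2 * M + 1 / 2) := h0.intSizeReduce hM0 hsred' hjk
  have hpow : (1 : ℝ) ≤ 2 ^ n := one_le_pow₀ (by norm_num)
  intro c hc
  simp only [intPassMatrices, dif_pos hk, List.mem_cons] at hc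
  rcases hc with rfl | rfl | hc
  · exact h0.mono (by nlinarith)
  · exact h1.mono (by nlinarith)
  · have h2 := PassGood.chain hsred' (s.k - 1) (by omega) (by simp [hkdef]) _ _ (by linarith) h1 c hc
    refine h2.mono ?_
    have hpow' : (2 : ℝ) ^ (s.k - 1) ≤ 2 ^ n := pow_le_pow_right₀ (by norm_num) (by omega)
    have : (2 : ℝ) ^ (s.k - 1) * (2 * M + 1 / 2 + 1 / 2) = 2 ^ (s.k - 1) * (2 * M + 1) := by ring
    rw [this]
    exact mul_le_mul_of_nonneg_right hpow' (by linarith)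

/-! ### From the shape to the sizes -/

/-- The squared norm of an integer vector is the sum of the squares of its entries. [folklore] -/
theorem sq_norm_intVecToEuclidean (v : Fin m → ℤ) : ‖intVecToEuclidean m v‖ ^ 2 = ∑ t, ((v t : ℝ)) ^ 2 := by
  rw [norm_intVecToEuclidean, Real.sq_sqrt (Finset.sum_nonneg fun t _ => sq_nonneg _)]

/-- An entry is at most the norm: `(vₜ)² ≤ ‖v‖²`. [folklore] -/
theorem sq_le_sq_norm_intVecToEuclidean (v : Fin m → ℤ) (t : Fin m) : ((v t : ℝ)) ^ 2 ≤ ‖intVecToEuclidean m v‖ ^ 2 := by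
  rw [sq_norm_intVecToEuclidean]
  exact Finset.single_le_sum (f := fun t => ((v t : ℝ)) ^ 2) (fun t _ => sq_nonneg _) (Finset.mem_univ t)

variable {s : LLLState n (Fin m → ℤ)} {k : Fin n} {c : Fin n → (Fin m → ℤ)} {M S₀ : ℝ}

/-- **Rows of a pass matrix**: if every row of the state has `‖bᵢ‖² ≤ S₀` and `M ≥ 1`, then every
row of `c` has `‖cᵢ‖² ≤ n M² S₀` (row `k` by `‖cₖ‖² = ∑ μₖⱼ² ‖b*ⱼ‖² + ‖b*ₖ‖²`, Bremner (4.7); the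
others are rows of the state). [cite: Bremner2011, Thm. 4.23 (4.7)] [cite: LenstraLenstraLovasz1982, Prop. 1.26 (proof)] -/
theorem PassGood.sq_norm_le (h : PassGood s k c M) (hM1 : 1 ≤ M) (hS : ∀ i, ‖intVecToEuclidean m (s.b i)‖ ^ 2 ≤ S₀)
    (i : Fin n) : ‖intVecToEuclidean m (c i)‖ ^ 2 ≤ n * M ^ 2 * S₀ := by
  have hn : (1 : ℝ) ≤ n := Nat.one_le_cast.2 (Fin.pos k)
  have hS0 : 0 ≤ S₀ := (sq_nonneg _).trans (hS k)
  have hGS : ∀ j, ‖gramSchmidt ℝ (⇑φ ∘ c) j‖ ^ 2 ≤ S₀ := fun j => by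
    rw [h.gs]
    exact (pow_le_pow_left₀ (norm_nonneg _) (norm_gramSchmidt_le _ j) 2).trans (hS j)
  by_cases hik : i = k
  · subst hik
    exact sq_norm_le_of_abs_gsCoeff_le (⇑φ ∘ c) hGS hM1 i h.coeff
  · have e : c i = s.b i := h.rows i hik
    rw [e]
    calc ‖intVecToEuclidean m (s.b i)‖ ^ 2 ≤ S₀ := hS i
      _ = 1 * 1 ^ 2 * S₀ := by ring
      _ ≤ n * M ^ 2 * S₀ := by gcongr

/-- **A pass matrix fits any width `W` with `S₀ⁿ · (n M² S₀) < 2ᵂ`** (state rows `≤ S₀`, `S₀ ≥ 1`,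
`M ≥ 1`): entries by `|cᵢₜ| ≤ ‖cᵢ‖`, the `u`-table by `|uₗ(i,j)| ≤ dₗ ‖cᵢ‖ ‖cⱼ‖ ≤ S₀ˡ · n M² S₀`
(`dₗ ≤ S₀ˡ` as all `‖b*ⱼ‖² ≤ S₀`). [cite: LenstraLenstraLovasz1982, Prop. 1.26 (proof)] -/
theorem PassGood.fits (h : PassGood s k c M) (hM1 : 1 ≤ M) (hS : ∀ i, ‖intVecToEuclidean m (s.b i)‖ ^ 2 ≤ S₀)
    (hS1 : 1 ≤ S₀) {W : ℕ} (hW : S₀ ^ n * (n * M ^ 2 * S₀) < 2 ^ W) : Fits W c := by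
  set S₁ : ℝ := n * M ^ 2 * S₀ with hS₁
  have hrow : ∀ i, ‖intVecToEuclidean m (c i)‖ ^ 2 ≤ S₁ := fun i => h.sq_norm_le hM1 hS i
  have hS₁0 : 0 ≤ S₁ := (sq_nonneg _).trans (hrow k)
  have hpow1 : (1 : ℝ) ≤ S₀ ^ n := one_le_pow₀ hS1
  have hS₁W : S₁ < 2 ^ W := lt_of_le_of_lt (le_mul_of_one_le_left hS₁0 hpow1) hW
  -- a real bound turns into `natAbs < 2^W`
  have key : ∀ z : ℤ, |(z : ℝ)| ≤ S₀ ^ n * S₁ → z.natAbs < 2 ^ W := by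
    intro z hz
    have hlt : |(z : ℝ)| < (2 : ℝ) ^ W := lt_of_le_of_lt hz hW
    have : (z.natAbs : ℝ) < (2 : ℝ) ^ W := by rw [Nat.cast_natAbs, Int.cast_abs]; exact hlt
    exact_mod_cast this
  refine ⟨fun l i j hlj hji => key _ ?_, fun i t => key _ ?_⟩
  · -- the `u`-table
    have hl : l ≤ n := hlj.trans j.isLt.le
    rw [uRec_cast_eq_gsU c h.indep l hl i j]
    have hGS : ∀ j, ‖gramSchmidt ℝ (⇑φ ∘ c) j‖ ^ 2 ≤ S₀ := fun j => by
      rw [h.gs]; exact (pow_le_pow_left₀ (norm_nonneg _) (norm_gramSchmidt_le _ j) 2).trans (hS j)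
    have hd : gramDet (⇑φ ∘ c) l hl ≤ S₀ ^ n :=
      (gramDet_le_pow_of_gramSchmidt _ hGS l hl).trans (pow_le_pow_right₀ hS1 hl)
    have hni : ‖(⇑φ ∘ c) i‖ * ‖(⇑φ ∘ c) j‖ ≤ S₁ := by
      have hi' : ‖(⇑φ ∘ c) i‖ ^ 2 ≤ S₁ := hrow i
      have hj' : ‖(⇑φ ∘ c) j‖ ^ 2 ≤ S₁ := hrow j
      nlinarith [norm_nonneg ((⇑φ ∘ c) i), norm_nonneg ((⇑φ ∘ c) j), sq_nonneg (‖(⇑φ ∘ c) i‖ - ‖(⇑φ ∘ c) j‖)]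
    calc |gsU (⇑φ ∘ c) l hl i j| ≤ gramDet (⇑φ ∘ c) l hl * ‖(⇑φ ∘ c) i‖ * ‖(⇑φ ∘ c) j‖ := abs_gsU_le _ l hl i j
      _ = gramDet (⇑φ ∘ c) l hl * (‖(⇑φ ∘ c) i‖ * ‖(⇑φ ∘ c) j‖) := by ring
      _ ≤ S₀ ^ n * S₁ := mul_le_mul hd hni (mul_nonneg (norm_nonneg _) (norm_nonneg _)) (by positivity)
  · -- the entries
    have h1 : ((c i t : ℝ)) ^ 2 ≤ S₁ := (sq_le_sq_norm_intVecToEuclidean (c i) t).trans (hrow i)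
    have hS₁1 : 1 ≤ S₁ := by
      have hn : (1 : ℝ) ≤ n := Nat.one_le_cast.2 (Fin.pos k)
      have hM2 : (1 : ℝ) ≤ M ^ 2 := one_le_pow₀ hM1
      calc (1 : ℝ) = 1 * 1 * 1 := by ring
        _ ≤ n * M ^ 2 * S₀ := by gcongr
    have h2 : |(c i t : ℝ)| ≤ S₁ := by
      rcases le_or_gt |(c i t : ℝ)| 1 with hle | hgt
      · exact hle.trans hS₁1
      · have : |(c i t : ℝ)| ≤ |(c i t : ℝ)| ^ 2 := by nlinarith
        rw [sq_abs] at this; exact this.trans h1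
    exact h2.trans (le_mul_of_one_le_left hS₁0 hpow1)

end Pass

/-! ### The budget polynomial and the size arithmetic -/

section Budget

/-- **The common polynomial budget of the LLL machine** in the input length `L`: the width of the
saturated integers and the number of rounds of every loop, `64 (L+1)³`. [folklore] -/
def lllBudget (L : ℕ) : ℕ := 64 * (L + 1) ^ 3

/-- The bound `B = n M² + 1` on the squared input norms (`M` the largest entry). [folklore] -/
def lllB (n Mx : ℕ) : ℕ := n * Mx ^ 2 + 1

/-- LLL82's bound `S₀ = n² (4B)ⁿ` on all squared norms along the run. [cite: LenstraLenstraLovasz1982, Prop. 1.26 (proof)] -/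
def lllS0 (n Mx : ℕ) : ℕ := n ^ 2 * (4 * lllB n Mx) ^ n

/-- The bound `2ⁿ (2 S₀ⁿ + 1)` on the Gram–Schmidt coefficients of the rows met during a pass. [folklore] -/
def lllM (n Mx : ℕ) : ℕ := 2 ^ n * (2 * lllS0 n Mx ^ n + 1)

/-- `B ≤ 2^{3L}` for `n ≤ L`, `M < 2ᴸ`. [folklore] -/
theorem lllB_le {L n Mx : ℕ} (hn : n ≤ L) (hM : Mx < 2 ^ L) : lllB n Mx ≤ 2 ^ (3 * L) := by
  have hnL : n ≤ 2 ^ L := hn.trans (Nat.lt_two_pow_self).le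
  have hM2 : Mx ^ 2 + 1 ≤ 2 ^ (2 * L) := by
    have : (Mx + 1) ^ 2 ≤ (2 ^ L) ^ 2 := Nat.pow_le_pow_left hM 2
    rw [← pow_mul, Nat.mul_comm] at this
    nlinarith
  unfold lllB
  calc n * Mx ^ 2 + 1 ≤ 2 ^ L * Mx ^ 2 + 2 ^ L := Nat.add_le_add (Nat.mul_le_mul_right _ hnL) Nat.one_le_two_pow
    _ = 2 ^ L * (Mx ^ 2 + 1) := by ring
    _ ≤ 2 ^ L * 2 ^ (2 * L) := Nat.mul_le_mul_left _ hM2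
    _ = 2 ^ (3 * L) := by rw [← pow_add]; congr 1; ring

/-- `S₀ ≤ 2^{3L² + 4L}`. [folklore] -/
theorem lllS0_le {L n Mx : ℕ} (hn : n ≤ L) (hM : Mx < 2 ^ L) : lllS0 n Mx ≤ 2 ^ (3 * L ^ 2 + 4 * L) := by
  have hnL : n ≤ 2 ^ L := hn.trans (Nat.lt_two_pow_self).le
  have hB := lllB_le hn hM
  have h4B : 4 * lllB n Mx ≤ 2 ^ (3 * L + 2) := by
    rw [pow_add]; nlinarith
  unfold lllS0
  calc n ^ 2 * (4 * lllB n Mx) ^ n ≤ (2 ^ L) ^ 2 * (2 ^ (3 * L + 2)) ^ n :=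
        Nat.mul_le_mul (Nat.pow_le_pow_left hnL 2) (Nat.pow_le_pow_left h4B n)
    _ ≤ (2 ^ L) ^ 2 * (2 ^ (3 * L + 2)) ^ L :=
        Nat.mul_le_mul_left _ (Nat.pow_le_pow_right Nat.one_le_two_pow hn)
    _ = 2 ^ (3 * L ^ 2 + 4 * L) := by rw [← pow_mul, ← pow_mul, ← pow_add]; congr 1; ring

/-- **The size arithmetic of the width**: `S₀ⁿ · (n M² S₀) < 2^{lllBudget L}` (the exponent on the left
is at most `9L³ + 15L² + 7L + 4`). [folklore] -/
theorem lll_size_budget {L n Mx : ℕ} (hn : n ≤ L) (hM : Mx < 2 ^ L) :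
    lllS0 n Mx ^ n * (n * lllM n Mx ^ 2 * lllS0 n Mx) < 2 ^ lllBudget L := by
  set e₀ := 3 * L ^ 2 + 4 * L with he₀
  have hnL : n ≤ 2 ^ L := hn.trans (Nat.lt_two_pow_self).le
  have hS := lllS0_le hn hM
  have hSn : lllS0 n Mx ^ n ≤ 2 ^ (e₀ * L) := by
    calc lllS0 n Mx ^ n ≤ (2 ^ e₀) ^ n := Nat.pow_le_pow_left hS n
      _ ≤ (2 ^ e₀) ^ L := Nat.pow_le_pow_right Nat.one_le_two_pow hn
      _ = 2 ^ (e₀ * L) := by rw [← pow_mul]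
  have hMle : lllM n Mx ≤ 2 ^ (e₀ * L + L + 2) := by
    unfold lllM
    have h1 : 2 * lllS0 n Mx ^ n + 1 ≤ 2 ^ (e₀ * L + 2) := by
      have := Nat.one_le_two_pow (n := e₀ * L)
      rw [pow_add]; omega
    calc 2 ^ n * (2 * lllS0 n Mx ^ n + 1) ≤ 2 ^ L * 2 ^ (e₀ * L + 2) :=
          Nat.mul_le_mul (Nat.pow_le_pow_right (by norm_num) hn) h1
      _ = 2 ^ (e₀ * L + L + 2) := by rw [← pow_add]; congr 1; ring
  have htot : lllS0 n Mx ^ n * (n * lllM n Mx ^ 2 * lllS0 n Mx) ≤ 2 ^ (3 * e₀ * L + 3 * L + 4 + e₀) := by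
    calc lllS0 n Mx ^ n * (n * lllM n Mx ^ 2 * lllS0 n Mx)
        ≤ 2 ^ (e₀ * L) * (2 ^ L * (2 ^ (e₀ * L + L + 2)) ^ 2 * 2 ^ e₀) :=
          Nat.mul_le_mul hSn (Nat.mul_le_mul (Nat.mul_le_mul hnL (Nat.pow_le_pow_left hMle 2)) hS)
      _ = 2 ^ (3 * e₀ * L + 3 * L + 4 + e₀) := by rw [← pow_mul, ← pow_add, ← pow_add, ← pow_add]; congr 1; ring
  refine lt_of_le_of_lt htot (Nat.pow_lt_pow_right (by norm_num) ?_)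
  rw [he₀, lllBudget]
  nlinarith [Nat.zero_le L, Nat.zero_le (L ^ 2), Nat.zero_le (L ^ 3)]

/-- The halting time of LLL82 is within the budget: `(n - 1) + 2 · 6L³ ≤ lllBudget L` for `n ≤ L`. [folklore] -/
theorem lll_time_budget {L n : ℕ} (hn : n ≤ L) : (n - 1) + 2 * (6 * L ^ 3) ≤ lllBudget L := by
  unfold lllBudget; nlinarith [Nat.zero_le L, Nat.zero_le (L ^ 2), Nat.sub_le n 1]

end Budget

/-! ### The run of a nonsingular instance -/

namespace LatticeInstance

open _root_.Computability Literature.Computability.Complexity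

variable (I : LatticeInstance)

/-- **Every entry of the basis is shorter than the whole code**: `|Bᵢⱼ| < 2^{|encode I|}` (the entry's
sign–magnitude code, `|bin |Bᵢⱼ|| + 4` symbols, is a segment of the code). [cite: MicciancioGoldwasser2002, Ch. 1 §1.3 (size of the input)] -/
theorem natAbs_basis_lt_two_pow (i j : Fin I.n) : (I.basis i j).natAbs < 2 ^ I.encode.length := by
  -- the row-major entry list
  set F : Fin (I.n * I.n) → ℤ := fun m => I.basis (finProdFinEquiv.symm m).1 (finProdFinEquiv.symm m).2 with hF
  have henc : I.encode = encodeNatSD I.n ++ encodingIntBool.listBool.encode (List.ofFn F) := I.encode_eq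
  have hfold : ∀ l : List ℤ, (l.foldr (fun a acc => boolPair (encodingIntBool.encode a) acc) []).length
      = (l.map fun a => 2 * (encodingIntBool.encode a).length + 2).sum := by
    intro l
    induction l with
    | nil => rfl
    | cons a l ih => simp only [List.foldr_cons, length_boolPair, ih, List.map_cons, List.sum_cons]
  have hun : ∀ k : ℕ, (unaryEncodeNat k).length = k := by
    intro k
    induction k with
    | zero => rfl
    | succ k ih => simp [unaryEncodeNat, ih]
  have hlist : (encodingIntBool.listBool.encode (List.ofFn F)).length =
      2 * (I.n * I.n) + 2 + ((List.ofFn F).map fun a => 2 * (encodingIntBool.encode a).length + 2).sum := by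
    simp only [Encoding.listBool, length_boolPair, hfold, List.length_ofFn, hun]
  -- the entry `(i, j)` is a member of the list
  have hmem : I.basis i j ∈ List.ofFn F := by
    rw [List.mem_ofFn]; exact ⟨finProdFinEquiv (i, j), by simp only [hF, Equiv.symm_apply_apply]⟩
  have hterm : 2 * (encodingIntBool.encode (I.basis i j)).length + 2 ≤
      ((List.ofFn F).map fun a => 2 * (encodingIntBool.encode a).length + 2).sum :=
    List.single_le_sum (fun _ _ => Nat.zero_le _) _ (List.mem_map.2 ⟨_, hmem, rfl⟩)
  have hcode : (encodingIntBool.encode (I.basis i j)).length = (encodeNat (I.basis i j).natAbs).length + 4 := by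
    have : encodingIntBool.encode (I.basis i j) = boolPair [decide (I.basis i j < 0)] (encodeNat (I.basis i j).natAbs) := rfl
    rw [this, length_boolPair]; simp only [List.length_cons, List.length_nil]; omega
  have hlen : (encodeNat (I.basis i j).natAbs).length ≤ I.encode.length := by
    rw [henc, List.length_append, hlist]; omega
  have hlt := bitsToNat_lt (encodeNat (I.basis i j).natAbs)
  rw [bitsToNat_encodeNat] at hlt
  exact lt_of_lt_of_le hlt (Nat.pow_le_pow_right (by norm_num) hlen)

/-- `maxEntry I < 2^{|encode I|}`. [folklore] -/
theorem maxEntry_lt_two_pow : I.maxEntry < 2 ^ I.encode.length := by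
  unfold maxEntry
  rw [Finset.sup_lt_iff (Nat.one_le_two_pow)]
  exact fun ij _ => I.natAbs_basis_lt_two_pow ij.1 ij.2

/-- The squared norms of the input rows are at most `B = n M² + 1`. [folklore] -/
theorem sq_norm_row_le_lllB (i : Fin I.n) :
    ‖intVecToEuclidean I.n (I.basis i)‖ ^ 2 ≤ (lllB I.n I.maxEntry : ℝ) := by
  rw [sq_norm_intVecToEuclidean]
  have hM : ∀ t, ((I.basis i t : ℝ)) ^ 2 ≤ (I.maxEntry : ℝ) ^ 2 := by
    intro t
    have h1 : |(I.basis i t : ℝ)| ≤ I.maxEntry := by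
      rw [← Int.cast_abs, Int.abs_eq_natAbs]; exact_mod_cast I.natAbs_le_maxEntry i t
    calc ((I.basis i t : ℝ)) ^ 2 = |(I.basis i t : ℝ)| ^ 2 := (sq_abs _).symm
      _ ≤ (I.maxEntry : ℝ) ^ 2 := pow_le_pow_left₀ (abs_nonneg _) h1 2
  calc ∑ t, ((I.basis i t : ℝ)) ^ 2 ≤ ∑ _t : Fin I.n, (I.maxEntry : ℝ) ^ 2 := Finset.sum_le_sum fun t _ => hM t
    _ = I.n * (I.maxEntry : ℝ) ^ 2 := by simp
    _ ≤ (lllB I.n I.maxEntry : ℝ) := by unfold lllB; push_cast; linarith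

set_option quotPrecheck false in
set_option hygiene false in
/-- The measuring map `ℤⁿ → ℝⁿ` of the instance (local shorthand). -/
local notation "φI" => (intVecToEuclidean I.n).toAddMonoidHom

/-- **Along the run of LLL on a nonsingular instance every pass matrix fits the budget width.**
(LLL82, proof of Prop. 1.26: all integers met have length `O(n log B)`; here the crude polynomial
form `< 2^{64(L+1)³}`.) [cite: LenstraLenstraLovasz1982, Prop. 1.26 (proof)] -/
theorem fits_run (hI : I.IsNonsingular) (t : ℕ) :
    ∀ c ∈ intPassMatrices (intStep^[t] (lllStart I.basis)), Fits (lllBudget I.encode.length) c := by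
  have hli : LinearIndependent ℝ (⇑φI ∘ I.basis) := linearIndependent_vec hI
  set n := I.n with hn
  set L := I.encode.length with hL
  set S₀ : ℝ := (lllS0 I.n I.maxEntry : ℝ) with hS₀
  set M : ℝ := (lllM I.n I.maxEntry : ℝ) with hM
  have hnL : I.n ≤ L := I.n_le_length_encode
  have hMx := I.maxEntry_lt_two_pow
  rw [iterate_intStep_eq I.basis hli t]
  set s := (lllStep φI (3 / 4))^[t] (lllStart I.basis) with hs
  by_cases hk : 0 < s.k ∧ s.k < I.n
  swap
  · intro c hc; simp [intPassMatrices, hk] at hc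
  have hnpos : 0 < I.n := lt_of_le_of_lt (Nat.zero_le _) hk.2
  -- the state bounds of LLL82 (`lll_norm_sq_le`)
  have hrows : ∀ i, ‖intVecToEuclidean I.n (s.b i)‖ ^ 2 ≤ S₀ := by
    intro i
    have h := lll_norm_sq_le_holds (3 / 4) (lllB I.n I.maxEntry : ℝ) I.basis (by norm_num) (by norm_num) hli I.sq_norm_row_le_lllB t i
    rw [hS₀, lllS0]; push_cast
    exact h
  have hS1 : 1 ≤ S₀ := by
    rw [hS₀, lllS0]
    have h1 : 1 ≤ I.n ^ 2 := Nat.one_le_pow _ _ hnpos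
    have h2 : 1 ≤ (4 * lllB I.n I.maxEntry) ^ I.n := Nat.one_le_pow _ _ (by unfold lllB; omega)
    exact_mod_cast Nat.mul_le_mul h1 h2
  have hli_s : LinearIndependent ℝ (⇑φI ∘ s.b) := linearIndependent_iterate φI (3 / 4) I.basis hli t
  have hsred : ∀ i j : Fin I.n, j < i → (i : ℕ) < s.k → |gsCoeff (⇑φI ∘ s.b) i j| ≤ 1 / 2 :=
    (iterate_lllStep_invariant φI (3 / 4) I.basis t).1
  -- the coefficients of the current row: `|μₖⱼ| ≤ S₀ⁿ`
  have hGS : ∀ j, ‖gramSchmidt ℝ (⇑φI ∘ s.b) j‖ ^ 2 ≤ S₀ := fun j =>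
    (pow_le_pow_left₀ (norm_nonneg _) (norm_gramSchmidt_le _ j) 2).trans (hrows j)
  have hμ : ∀ j : Fin I.n, (j : ℕ) < s.k → |gsCoeff (⇑φI ∘ s.b) ⟨s.k, hk.2⟩ j| ≤ S₀ ^ I.n := by
    intro j hj
    have h1 := gsCoeff_sq_le_gramDet_mul (⇑φI ∘ s.b) ⟨s.k, hk.2⟩ j (one_le_gramDet s.b hli_s _ _)
    have h2 : gramDet (⇑φI ∘ s.b) j (le_of_lt j.isLt) ≤ S₀ ^ (j : ℕ) := gramDet_le_pow_of_gramSchmidt _ hGS _ _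
    have h3 : gsCoeff (⇑φI ∘ s.b) ⟨s.k, hk.2⟩ j ^ 2 ≤ S₀ ^ I.n := by
      calc _ ≤ gramDet (⇑φI ∘ s.b) j (le_of_lt j.isLt) * ‖(⇑φI ∘ s.b) ⟨s.k, hk.2⟩‖ ^ 2 := h1
        _ ≤ S₀ ^ (j : ℕ) * S₀ := mul_le_mul h2 (hrows _) (sq_nonneg _) (pow_nonneg (by linarith) _)
        _ = S₀ ^ ((j : ℕ) + 1) := (pow_succ _ _).symm
        _ ≤ S₀ ^ I.n := pow_le_pow_right₀ hS1 (by omega)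
    have hpow1 : (1 : ℝ) ≤ S₀ ^ I.n := one_le_pow₀ hS1
    rcases le_or_gt |gsCoeff (⇑φI ∘ s.b) ⟨s.k, hk.2⟩ j| 1 with hle | hgt
    · exact hle.trans hpow1
    · have : |gsCoeff (⇑φI ∘ s.b) ⟨s.k, hk.2⟩ j| ≤ |gsCoeff (⇑φI ∘ s.b) ⟨s.k, hk.2⟩ j| ^ 2 := by nlinarith
      rw [sq_abs] at this; exact this.trans h3
  have hM1 : (1 : ℝ) ≤ M := by rw [hM]; exact_mod_cast Nat.one_le_iff_ne_zero.2 (by unfold lllM; positivity)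
  have hMeq : (2 : ℝ) ^ I.n * (2 * S₀ ^ I.n + 1) = M := by rw [hM, hS₀, lllM]; push_cast; ring
  have hW : S₀ ^ I.n * (I.n * M ^ 2 * S₀) < (2 : ℝ) ^ lllBudget L := by
    rw [hS₀, hM]; exact_mod_cast lll_size_budget hnL hMx
  intro c hc
  have hgood := passGood_of_mem_intPassMatrices s hk hli_s hsred (pow_nonneg (by linarith) _) hμ c hc
  rw [hMeq] at hgood
  exact hgood.fits hM1 hrows hS1 hW

/-- **The saturated machine model runs through the states of LLL** on a nonsingular instance.
[cite: LenstraLenstraLovasz1982, Prop. 1.26] [cite: Cohen1993, Algorithm 2.6.7] -/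
theorem iterate_capStep_eq (hI : I.IsNonsingular) (t : ℕ) :
    (capStep (lllBudget I.encode.length))^[t] (lllStart I.basis) =
      (lllStep φI (3 / 4))^[t] (lllStart I.basis) := by
  rw [← iterate_intStep_eq I.basis (linearIndependent_vec hI) t]
  induction t with
  | zero => rfl
  | succ t ih => rw [iterate_succ_apply', iterate_succ_apply', ih, capStep_eq_intStep _ (I.fits_run hI t)]

/-- **LLL halts within the budget** on a nonsingular instance: the state at time `lllBudget L` is
halted (`n ≤ k`). [cite: LenstraLenstraLovasz1982, Prop. 1.26 (proof)] -/
theorem halted_budget (hI : I.IsNonsingular) :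
    I.n ≤ ((lllStep φI (3 / 4))^[lllBudget I.encode.length] (lllStart I.basis)).k := by
  have hli : LinearIndependent ℝ (⇑φI ∘ I.basis) := linearIndependent_vec hI
  set L := I.encode.length with hL
  have hnL : I.n ≤ L := I.n_le_length_encode
  have hMx := I.maxEntry_lt_two_pow
  have hB := lllB_le hnL hMx
  have h := lll_halts_within_holds (3 / 4) (lllB I.n I.maxEntry : ℝ) I.basis (by norm_num) (by norm_num) hli I.sq_norm_row_le_lllB
  -- the printed halting time is within the budget
  set T₀ := (I.n - 1) + 2 * ⌊((I.n : ℝ) * (I.n - 1) / 2) * Real.log (lllB I.n I.maxEntry : ℝ) / Real.log (1 / (3 / 4 : ℝ))⌋₊ with hT₀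
  have hT : T₀ ≤ lllBudget L := by
    have hlog43 : (1 : ℝ) / 4 ≤ Real.log (1 / (3 / 4 : ℝ)) := by
      have := Real.one_sub_inv_le_log_of_pos (x := 1 / (3 / 4 : ℝ)) (by norm_num)
      norm_num at this ⊢; linarith
    have hBpos : (0 : ℝ) < (lllB I.n I.maxEntry : ℝ) := by unfold lllB; positivity
    have hlogB : Real.log (lllB I.n I.maxEntry : ℝ) ≤ 3 * L := by
      have h1 : (lllB I.n I.maxEntry : ℝ) ≤ (2 : ℝ) ^ (3 * L) := by exact_mod_cast hB
      have h2 := Real.log_le_log hBpos h1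
      rw [Real.log_pow] at h2
      have h3 : Real.log 2 ≤ 1 := by
        have := Real.log_le_sub_one_of_pos (x := 2) (by norm_num); linarith
      have h4 : ((3 * L : ℕ) : ℝ) * Real.log 2 ≤ (3 * L : ℕ) * 1 := mul_le_mul_of_nonneg_left h3 (by positivity)
      push_cast at h2 h4 ⊢; linarith
    have hlogB0 : 0 ≤ Real.log (lllB I.n I.maxEntry : ℝ) := Real.log_nonneg (by unfold lllB; exact_mod_cast Nat.le_add_left 1 _)
    have hnn : (I.n : ℝ) * (I.n - 1) / 2 ≤ (L : ℝ) ^ 2 / 2 := by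
      have hn' : (I.n : ℝ) ≤ L := by exact_mod_cast hnL
      rcases Nat.eq_zero_or_pos I.n with h0 | hpos
      · rw [h0]; simp; positivity
      · have h1 : (1 : ℝ) ≤ I.n := by exact_mod_cast hpos
        nlinarith
    have hval : ((I.n : ℝ) * (I.n - 1) / 2) * Real.log (lllB I.n I.maxEntry : ℝ) / Real.log (1 / (3 / 4 : ℝ)) ≤ (6 * L ^ 3 : ℕ) := by
      rw [div_le_iff₀ (lt_of_lt_of_le (by norm_num) hlog43)]
      have h1 : ((I.n : ℝ) * (I.n - 1) / 2) * Real.log (lllB I.n I.maxEntry : ℝ) ≤ (L : ℝ) ^ 2 / 2 * (3 * L) :=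
        mul_le_mul hnn hlogB hlogB0 (by positivity)
      have h2 : ((6 * L ^ 3 : ℕ) : ℝ) * (1 / 4) ≤ (6 * L ^ 3 : ℕ) * Real.log (1 / (3 / 4 : ℝ)) :=
        mul_le_mul_of_nonneg_left hlog43 (by positivity)
      push_cast at h1 h2 ⊢
      nlinarith
    have hfloor : ⌊((I.n : ℝ) * (I.n - 1) / 2) * Real.log (lllB I.n I.maxEntry : ℝ) / Real.log (1 / (3 / 4 : ℝ))⌋₊ ≤ 6 * L ^ 3 :=
      Nat.floor_le_of_le hval
    calc T₀ ≤ (I.n - 1) + 2 * (6 * L ^ 3) := Nat.add_le_add_left (Nat.mul_le_mul_left 2 hfloor) _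
      _ ≤ lllBudget L := lll_time_budget hnL
  rw [iterate_lllStep_eq_of_halted φI hT h]
  exact h

/-- **The functional half of `lllReduce_polyTime`**: on a nonsingular instance, `lllBudget L` rounds
of the saturated integral step at width `lllBudget L` from the start state carry exactly the
output of LLL82's algorithm, `LatticeInstance.lllReduce`. [cite: LenstraLenstraLovasz1982, Prop. 1.26] -/
theorem lllReduce_eq_capRun (hI : I.IsNonsingular) :
    I.lllReduce = ⟨I.n, ((capStep (lllBudget I.encode.length))^[lllBudget I.encode.length] (lllStart I.basis)).b⟩ := by
  rw [I.iterate_capStep_eq hI, ← lllResult_eq_of_halted φI (I.halted_budget hI)]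
  rfl

end LatticeInstance

end Literature.Algebra.EuclideanLattices
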